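import Summits.Ventures.PercRepro.ProfilePointedParallel
import Summits.Ventures.PercRepro.ProfilePointedColoopExtension

/-!
# PercRepro — (Ĉ) IS CLOSED UNDER PARALLEL EXTENSION AWAY FROM THE POINT: MINIMAL (Ĉ)-WITNESSES ARE SIMPLE
(p10, gen 23; `proofs/P10-DIRECTSUM-g23.md` §6; modulo Theorem A = the named fact)

Let `{f, g}` be a parallel pair of `M` (`ρ{f} = ρ{g} = ρ{f, g} = 1`) NOT containing the point `p`, and
`N₁ = (M ∖ g) / f`, `N₂ = (M ∖ f) / g` the two minors on `#E − 2` elements.  Every bi-independent set of `M` contains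
exactly one of `f, g` (gen 13), the bi-independent `k`-sets through `f` are `BI_{k−1}(N₁)` plus `f`
(`card_filter_biIndepSets_parallel_half`, gen 13 — here as the membership equivalence
`mem_biIndepSets_erase_parallel_iff`), and THIS FILE shows that the same bijection carries the `p`-extendable sets
along (`card_filter_ext_parallel_half`): `c^p_k(M) = c^p_{k−1}(N₁) + c^p_{k−1}(N₂)` (`extCount_parallel_pair`), beside
gen 13's `P_k(M) = P_{k−1}(N₁) + P_{k−1}(N₂)`.  Hence (Ĉ) at `(M, p, k)` is the SUM of (Ĉ) at `(N₁, p, k−1)` and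
`(N₂, p, k−1)` plus the monotonicity `P_{k−1} ≤ P_k` of the two minors (Theorem A on `#E − 2` elements, exactly inside
the window) — `pointedRow_of_parallel_pair_of_fact`, `pointedRowAt_of_parallel_pair_of_fact`; level `0` is empty
(`card_biIndepSets_zero_parallel`).  CONSEQUENCE (`not_pointedRowAt_parallel_pair_of_fact`): a (Ĉ)-failure at `(M, p)`
with a parallel pair avoiding `p` is already a failure at one of the two minors, on `#E − 2` elements; with gen 13's
`pointedRow_parallel_of_fact` (`p` itself is never in a parallel pair of a witness) and `card_biIndepSets_eq_zero_of_loop`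
(a loop kills every bi-independent set), MINIMAL (Ĉ)-WITNESSES ARE SIMPLE — modulo the named fact.  Nothing here
asserts (Ĉ).
-/

open scoped Matroid

namespace PercRepro.Cogirth

open Finset ThmH Skew

variable {α : Type} [DecidableEq α] {M : Matroid α} [M.Finite]

/-- A loop kills every bi-independent set: `P_k = 0` for every `k` when `ρ{ℓ} = 0` for some `ℓ ∈ E`. -/
theorem card_biIndepSets_eq_zero_of_loop {l : α} (hl : l ∈ gr M) (hl0 : rk M {l} = 0) (k : ℕ) :
    (biIndepSets M k).card = 0 := by
  rw [card_eq_zero, eq_empty_iff_forall_notMem]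
  intro X hX
  rw [mem_biIndepSets] at hX
  obtain ⟨-, -, hXr, hXc⟩ := hX
  by_cases hlX : l ∈ X
  · have := rk_eq_card_of_subset_of_rk_eq_card (singleton_subset_iff.2 hlX) hXr
    rw [hl0, card_singleton] at this
    omega
  · have := rk_eq_card_of_subset_of_rk_eq_card (singleton_subset_iff.2 (mem_sdiff.2 ⟨hl, hlX⟩)) hXc
    rw [hl0, card_singleton] at this
    omega

section parallel

variable {f g : α}

/-- **The bijection of gen 13 as a membership equivalence**: for `f ∈ X`, `g ∉ X`, `X` is bi-independent in `M`
(at level `k + 1`) iff `X ∖ f` is bi-independent in `(M ∖ g) / f` (at level `k`). -/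
theorem mem_biIndepSets_erase_parallel_iff (hf : f ∈ gr M) (hg : g ∈ gr M) (hfg' : f ≠ g)
    (hf1 : rk M {f} = 1) (hg1 : rk M {g} = 1) (hfg : rk M {f, g} = 1) {k : ℕ} {X : Finset α} (hfX : f ∈ X)
    (hgX : g ∉ X) :
    X ∈ biIndepSets M (k + 1) ↔ X.erase f ∈ biIndepSets ((M ＼ ({g} : Set α)) ／ ({f} : Set α)) k := by
  have hfind : (M ＼ ({g} : Set α)).Indep ({f} : Set α) := by
    have h : rk (M ＼ ({g} : Set α)) {f} = ({f} : Finset α).card := by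
      rw [rk_delete (singleton_subset_iff.2 (mem_erase.2 ⟨hfg', hf⟩)), hf1, card_singleton]
    have := indep_of_rk_eq_card' h
    rwa [coe_singleton] at this
  have hgrT : gr ((M ＼ ({g} : Set α)) ／ ({f} : Set α)) = ((gr M).erase g).erase f := by
    rw [gr_contract', gr_delete']
  constructor
  · intro hX
    rw [mem_biIndepSets] at hX
    obtain ⟨hXg, hXk, hXr, hXc⟩ := hX
    rw [mem_biIndepSets, hgrT]
    have hX'g : X.erase f ⊆ ((gr M).erase g).erase f := by
      intro x hx
      rw [mem_erase] at hx ⊢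
      exact ⟨hx.1, mem_erase.2 ⟨fun h => hgX (h ▸ hx.2), hXg hx.2⟩⟩
    have hX'g' : X.erase f ⊆ (gr (M ＼ ({g} : Set α))).erase f := by rw [gr_delete']; exact hX'g
    refine ⟨hX'g, by rw [card_erase_of_mem hfX, hXk]; omega, ?_, ?_⟩
    · have h := rk_contract_add_one hfind hX'g'
      rw [rk_delete (by rw [insert_erase hfX]; intro x hx; exact mem_erase.2 ⟨fun h' => hgX (h' ▸ hx), hXg hx⟩),
        insert_erase hfX, hXr] at h
      rw [card_erase_of_mem hfX]
      omega
    · have hgZ : g ∈ gr M \ X := mem_sdiff.2 ⟨hg, hgX⟩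
      have e1 : ((gr M).erase g).erase f \ X.erase f = (gr M \ X).erase g := by
        ext x
        simp only [mem_sdiff, mem_erase]
        constructor
        · rintro ⟨⟨hxf, hxg, hx⟩, hxX⟩
          exact ⟨hxg, hx, fun h => hxX ⟨hxf, h⟩⟩
        · rintro ⟨hxg, hx, hxX⟩
          exact ⟨⟨fun h => hxX (h ▸ hfX), hxg, hx⟩, fun h => hxX h.2⟩
      rw [e1]
      have hsub : (gr M \ X).erase g ⊆ (gr (M ＼ ({g} : Set α))).erase f := by
        rw [gr_delete']
        intro x hx
        rw [mem_erase, mem_sdiff] at hx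
        exact mem_erase.2 ⟨fun h => hx.2.2 (h ▸ hfX), mem_erase.2 ⟨hx.1, hx.2.1⟩⟩
      have h := rk_contract_add_one hfind hsub
      have hsub' : insert f ((gr M \ X).erase g) ⊆ (gr M).erase g := by
        intro x hx
        rw [mem_insert] at hx
        rcases hx with rfl | hx
        · exact mem_erase.2 ⟨hfg', hf⟩
        · rw [mem_erase, mem_sdiff] at hx
          exact mem_erase.2 ⟨hx.1, hx.2.1⟩
      rw [rk_delete hsub', rk_insert_eq_of_parallel' hf hg hf1 hg1 hfg ((erase_subset _ _).trans sdiff_subset),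
        insert_erase hgZ, hXc] at h
      have hc := card_erase_add_one hgZ
      omega
  · intro hY
    set Y := X.erase f with hYdef
    have hXY : X = insert f Y := (insert_erase hfX).symm
    rw [mem_biIndepSets, hgrT] at hY
    obtain ⟨hYg, hYk, hYr, hYc⟩ := hY
    have hfY : f ∉ Y := fun h => (mem_erase.1 (hYg h)).1 rfl
    have hgY : g ∉ Y := fun h => (mem_erase.1 (mem_erase.1 (hYg h)).2).1 rfl
    have hYg0 : Y ⊆ gr M := fun x hx => (mem_erase.1 (mem_erase.1 (hYg hx)).2).2
    have hYg1 : Y ⊆ (gr (M ＼ ({g} : Set α))).erase f := by rw [gr_delete']; exact hYg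
    rw [hXY, mem_biIndepSets]
    refine ⟨insert_subset hf hYg0, by rw [card_insert_of_notMem hfY, hYk], ?_, ?_⟩
    · have h := rk_contract_add_one hfind hYg1
      rw [rk_delete (insert_subset (mem_erase.2 ⟨hfg', hf⟩) (fun x hx => (mem_erase.1 (hYg hx)).2)),
        hYr] at h
      rw [← h, card_insert_of_notMem hfY]
    · set W := ((gr M).erase g).erase f \ Y with hW
      have e2 : gr M \ insert f Y = insert g W := by
        ext x
        simp only [hW, mem_sdiff, mem_insert, mem_erase, not_or]
        constructor
        · rintro ⟨hx, hxf, hxY⟩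
          by_cases hxg : x = g
          · exact Or.inl hxg
          · exact Or.inr ⟨⟨hxf, hxg, hx⟩, hxY⟩
        · rintro (rfl | ⟨⟨hxf, hxg, hx⟩, hxY⟩)
          · exact ⟨hg, hfg'.symm, hgY⟩
          · exact ⟨hx, hxf, hxY⟩
      have hWg : W ⊆ gr M := fun x hx => (mem_erase.1 (mem_erase.1 (mem_sdiff.1 hx).1).2).2
      have hgW : g ∉ W := fun h => (mem_erase.1 (mem_erase.1 (mem_sdiff.1 h).1).2).1 rfl
      have hWsub : W ⊆ (gr (M ＼ ({g} : Set α))).erase f := by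
        rw [gr_delete']
        exact sdiff_subset
      have h := rk_contract_add_one hfind hWsub
      have hsub' : insert f W ⊆ (gr M).erase g := by
        intro x hx
        rw [mem_insert] at hx
        rcases hx with rfl | hx
        · exact mem_erase.2 ⟨hfg', hf⟩
        · exact (mem_erase.1 (mem_sdiff.1 hx).1).2
      rw [rk_delete hsub', rk_insert_eq_of_parallel' hf hg hf1 hg1 hfg hWg, hYc] at h
      rw [e2, ← h, card_insert_of_notMem hgW]

/-- **The `p`-extendable half at a parallel pair**: for `p ∉ {f, g}`, the bi-independent `(k + 1)`-sets through `f`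
(not `g`) that extend by `p` are the extendable `k`-sets of `(M ∖ g) / f` plus `f`. -/
theorem card_filter_ext_parallel_half (hf : f ∈ gr M) (hg : g ∈ gr M) (hfg' : f ≠ g)
    (hf1 : rk M {f} = 1) (hg1 : rk M {g} = 1) (hfg : rk M {f, g} = 1) {p : α} (hpf : p ≠ f) (hpg : p ≠ g)
    (k : ℕ) :
    ((biIndepSets M (k + 1)).filter
        (fun X => (p ∉ X ∧ insert p X ∈ biIndepSets M (k + 1 + 1)) ∧ f ∈ X ∧ g ∉ X)).card =
      extCount ((M ＼ ({g} : Set α)) ／ ({f} : Set α)) k p := by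
  unfold extCount
  apply card_bij (fun X _ => X.erase f)
  · intro X hX
    rw [mem_filter] at hX ⊢
    obtain ⟨hX, ⟨hpX, hins⟩, hfX, hgX⟩ := hX
    refine ⟨(mem_biIndepSets_erase_parallel_iff hf hg hfg' hf1 hg1 hfg hfX hgX).1 hX, ?_, ?_⟩
    · exact fun h => hpX (mem_of_mem_erase h)
    · rw [← erase_insert_of_ne hpf]
      exact (mem_biIndepSets_erase_parallel_iff hf hg hfg' hf1 hg1 hfg (mem_insert_of_mem hfX)
        (fun h => (mem_insert.1 h).elim (fun h' => hpg h'.symm) hgX)).1 hins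
  · intro X hX Y hY h
    rw [mem_filter] at hX hY
    rw [← insert_erase hX.2.2.1, ← insert_erase hY.2.2.1, h]
  · intro Z hZ
    rw [mem_filter] at hZ
    obtain ⟨hZ, hpZ, hins⟩ := hZ
    have hZg : Z ⊆ ((gr M).erase g).erase f := by
      rw [mem_biIndepSets, gr_contract', gr_delete'] at hZ
      exact hZ.1
    have hfZ : f ∉ Z := fun h => (mem_erase.1 (hZg h)).1 rfl
    have hgZ : g ∉ Z := fun h => (mem_erase.1 (mem_erase.1 (hZg h)).2).1 rfl
    refine ⟨insert f Z, ?_, erase_insert hfZ⟩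
    rw [mem_filter]
    refine ⟨?_, ⟨?_, ?_⟩, mem_insert_self _ _, fun h => (mem_insert.1 h).elim (fun h' => hfg' h'.symm) hgZ⟩
    · exact (mem_biIndepSets_erase_parallel_iff hf hg hfg' hf1 hg1 hfg (mem_insert_self _ _)
        (fun h => (mem_insert.1 h).elim (fun h' => hfg' h'.symm) hgZ)).2 (by rw [erase_insert hfZ]; exact hZ)
    · exact fun h => (mem_insert.1 h).elim hpf hpZ
    · apply (mem_biIndepSets_erase_parallel_iff hf hg hfg' hf1 hg1 hfg (mem_insert_of_mem (mem_insert_self _ _))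
        (fun h => (mem_insert.1 h).elim (fun h' => hpg h'.symm)
          (fun h' => (mem_insert.1 h').elim (fun h'' => hfg' h''.symm) hgZ))).2
      rw [erase_insert_of_ne hpf, erase_insert hfZ]
      exact hins

/-- **The extension counts at a parallel pair avoiding `p` split over the two minors**: for `k ≥ 1`,
`c^p_k(M) = c^p_{k−1}((M ∖ g) / f) + c^p_{k−1}((M ∖ f) / g)`. -/
theorem extCount_parallel_pair (hf : f ∈ gr M) (hg : g ∈ gr M) (hfg' : f ≠ g)
    (hf1 : rk M {f} = 1) (hg1 : rk M {g} = 1) (hfg : rk M {f, g} = 1) {p : α} (hpf : p ≠ f) (hpg : p ≠ g)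
    {k : ℕ} (hk : 1 ≤ k) :
    extCount M k p =
      extCount ((M ＼ ({g} : Set α)) ／ ({f} : Set α)) (k - 1) p +
        extCount ((M ＼ ({f} : Set α)) ／ ({g} : Set α)) (k - 1) p := by
  obtain ⟨j, rfl⟩ : ∃ j, k = j + 1 := ⟨k - 1, by omega⟩
  rw [show j + 1 - 1 = j by omega, ← card_filter_ext_parallel_half hf hg hfg' hf1 hg1 hfg hpf hpg j,
    ← card_filter_ext_parallel_half hg hf hfg'.symm hg1 hf1 (by rw [pair_comm]; exact hfg) hpg hpf j]
  unfold extCount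
  rw [← card_filter_add_card_filter_not
    (s := (biIndepSets M (j + 1)).filter (fun X => p ∉ X ∧ insert p X ∈ biIndepSets M (j + 1 + 1)))
    (fun X => f ∈ X), filter_filter, filter_filter]
  congr 1
  · congr 1
    ext X
    simp only [mem_filter, and_congr_right_iff]
    intro hX _
    constructor
    · intro hfX
      refine ⟨hfX, fun hgX => ?_⟩
      rw [mem_biIndepSets] at hX
      exact not_pair_subset_of_parallel' hfg' hfg hX.2.2.1 (insert_subset hfX (singleton_subset_iff.2 hgX))
    · exact fun h => h.1
  · congr 1
    ext X
    simp only [mem_filter, and_congr_right_iff]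
    intro hX _
    constructor
    · intro hfX
      refine ⟨?_, hfX⟩
      by_contra hgX
      rw [mem_biIndepSets] at hX
      obtain ⟨hXg, -, -, hXc⟩ := hX
      exact not_pair_subset_of_parallel' hfg' hfg hXc
        (insert_subset (mem_sdiff.2 ⟨hf, hfX⟩) (singleton_subset_iff.2 (mem_sdiff.2 ⟨hg, hgX⟩)))
    · exact fun h => h.2

/-- **(Ĉ) AT `(M, p, k)` FROM (Ĉ) AT `(N₁, p, k − 1)` AND `(N₂, p, k − 1)`** for a parallel pair `{f, g}` avoiding
`p` (CONDITIONAL on the named fact, through the monotonicity `P_{k−1} ≤ P_k` of the two minors on `#E − 2`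
elements; the splits of `P` and `c^p` are unconditional). -/
theorem pointedRow_of_parallel_pair_of_fact (hfact : BiIndepDensityLogConcave α) (M : Matroid α) [M.Finite]
    {p f g : α} (hf : f ∈ gr M) (hg : g ∈ gr M) (hfg' : f ≠ g) (hf1 : rk M {f} = 1) (hg1 : rk M {g} = 1)
    (hfg : rk M {f, g} = 1) (hpf : p ≠ f) (hpg : p ≠ g) (k : ℕ) (hk : 2 * k + 2 ≤ (gr M).card)
    (h1 : 1 ≤ k →
      ((gr ((M ＼ ({g} : Set α)) ／ ({f} : Set α))).card - (k - 1) - 1) *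
          (biIndepSets ((M ＼ ({g} : Set α)) ／ ({f} : Set α)) (k - 1)).card ≤
        (k - 1) * (biIndepSets ((M ＼ ({g} : Set α)) ／ ({f} : Set α)) (k - 1 + 1)).card +
          ((gr ((M ＼ ({g} : Set α)) ／ ({f} : Set α))).card - 2 * (k - 1) - 1) *
            extCount ((M ＼ ({g} : Set α)) ／ ({f} : Set α)) (k - 1) p)
    (h2 : 1 ≤ k →
      ((gr ((M ＼ ({f} : Set α)) ／ ({g} : Set α))).card - (k - 1) - 1) *
          (biIndepSets ((M ＼ ({f} : Set α)) ／ ({g} : Set α)) (k - 1)).card ≤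
        (k - 1) * (biIndepSets ((M ＼ ({f} : Set α)) ／ ({g} : Set α)) (k - 1 + 1)).card +
          ((gr ((M ＼ ({f} : Set α)) ／ ({g} : Set α))).card - 2 * (k - 1) - 1) *
            extCount ((M ＼ ({f} : Set α)) ／ ({g} : Set α)) (k - 1) p) :
    ((gr M).card - k - 1) * (biIndepSets M k).card ≤
      k * (biIndepSets M (k + 1)).card + ((gr M).card - 2 * k - 1) * extCount M k p := by
  have hN1 : (gr ((M ＼ ({g} : Set α)) ／ ({f} : Set α))).card = (gr M).card - 2 := by
    rw [gr_contract', gr_delete', card_erase_of_mem (mem_erase.2 ⟨hfg', hf⟩), card_erase_of_mem hg]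
    omega
  have hN2 : (gr ((M ＼ ({f} : Set α)) ／ ({g} : Set α))).card = (gr M).card - 2 := by
    rw [gr_contract', gr_delete', card_erase_of_mem (mem_erase.2 ⟨hfg'.symm, hg⟩), card_erase_of_mem hf]
    omega
  rcases Nat.eq_zero_or_pos k with rfl | hk1
  · rw [card_biIndepSets_zero_parallel hf hg hfg' hfg]
    simp
  · obtain ⟨j, rfl⟩ : ∃ j, k = j + 1 := ⟨k - 1, by omega⟩
    have h1' := h1 hk1
    have h2' := h2 hk1
    rw [show j + 1 - 1 = j by omega, hN1] at h1'
    rw [show j + 1 - 1 = j by omega, hN2] at h2'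
    rw [card_biIndepSets_parallel hf hg hfg' hf1 hg1 hfg hk1,
      card_biIndepSets_parallel hf hg hfg' hf1 hg1 hfg (by omega : 1 ≤ j + 1 + 1),
      extCount_parallel_pair hf hg hfg' hf1 hg1 hfg hpf hpg hk1, show j + 1 - 1 = j by omega,
      show j + 1 + 1 - 1 = j + 1 by omega]
    obtain ⟨m, hm⟩ := Nat.exists_eq_add_of_le hk
    have hA1 := biIndepDensity_mono_of_fact hfact ((M ＼ ({g} : Set α)) ／ ({f} : Set α)) j (by rw [hN1]; omega)
    have hA2 := biIndepDensity_mono_of_fact hfact ((M ＼ ({f} : Set α)) ／ ({g} : Set α)) j (by rw [hN2]; omega)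
    rw [hN1, hm] at hA1
    rw [hN2, hm] at hA2
    rw [hm] at h1' h2' ⊢
    rw [show 2 * (j + 1) + 2 + m - (j + 1) - 1 = j + 2 + m by omega,
      show 2 * (j + 1) + 2 + m - 2 * (j + 1) - 1 = m + 1 by omega]
    rw [show 2 * (j + 1) + 2 + m - 2 - j - 1 = j + 1 + m by omega,
      show 2 * (j + 1) + 2 + m - 2 - 2 * j - 1 = m + 1 by omega] at h1' h2'
    rw [show 2 * (j + 1) + 2 + m - 2 - j = j + 2 + m by omega] at hA1 hA2
    generalize (biIndepSets ((M ＼ ({g} : Set α)) ／ ({f} : Set α)) j).card = A0 at h1' hA1 ⊢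
    generalize (biIndepSets ((M ＼ ({g} : Set α)) ／ ({f} : Set α)) (j + 1)).card = A1 at h1' hA1 ⊢
    generalize (biIndepSets ((M ＼ ({f} : Set α)) ／ ({g} : Set α)) j).card = B0 at h2' hA2 ⊢
    generalize (biIndepSets ((M ＼ ({f} : Set α)) ／ ({g} : Set α)) (j + 1)).card = B1 at h2' hA2 ⊢
    generalize extCount ((M ＼ ({g} : Set α)) ／ ({f} : Set α)) j p = a at h1' ⊢
    generalize extCount ((M ＼ ({f} : Set α)) ／ ({g} : Set α)) j p = b at h2' ⊢
    have hA0 : A0 ≤ A1 := by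
      apply Nat.le_of_mul_le_mul_left (c := j + 1) _ (by omega)
      calc (j + 1) * A0 ≤ (j + 2 + m) * A0 := Nat.mul_le_mul_right _ (by omega)
        _ ≤ (j + 1) * A1 := hA1
    have hB0 : B0 ≤ B1 := by
      apply Nat.le_of_mul_le_mul_left (c := j + 1) _ (by omega)
      calc (j + 1) * B0 ≤ (j + 2 + m) * B0 := Nat.mul_le_mul_right _ (by omega)
        _ ≤ (j + 1) * B1 := hA2
    nlinarith [h1', h2', hA0, hB0]

/-- **(Ĉ) IS CLOSED UNDER PARALLEL EXTENSION AWAY FROM THE POINT** (CONDITIONAL on the named fact): for a parallel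
pair `{f, g}` of `M` avoiding `p`, (Ĉ) at every level of `((M ∖ g) / f, p)` and of `((M ∖ f) / g, p)` gives (Ĉ) at
every level of `(M, p)`. -/
theorem pointedRowAt_of_parallel_pair_of_fact (hfact : BiIndepDensityLogConcave α) (M : Matroid α) [M.Finite]
    {p f g : α} (hf : f ∈ gr M) (hg : g ∈ gr M) (hfg' : f ≠ g) (hf1 : rk M {f} = 1) (hg1 : rk M {g} = 1)
    (hfg : rk M {f, g} = 1) (hpf : p ≠ f) (hpg : p ≠ g)
    (h₁ : PointedRowAt ((M ＼ ({g} : Set α)) ／ ({f} : Set α)) p)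
    (h₂ : PointedRowAt ((M ＼ ({f} : Set α)) ／ ({g} : Set α)) p) : PointedRowAt M p := by
  intro k hk
  have hN1 : (gr ((M ＼ ({g} : Set α)) ／ ({f} : Set α))).card = (gr M).card - 2 := by
    rw [gr_contract', gr_delete', card_erase_of_mem (mem_erase.2 ⟨hfg', hf⟩), card_erase_of_mem hg]
    omega
  have hN2 : (gr ((M ＼ ({f} : Set α)) ／ ({g} : Set α))).card = (gr M).card - 2 := by
    rw [gr_contract', gr_delete', card_erase_of_mem (mem_erase.2 ⟨hfg'.symm, hg⟩), card_erase_of_mem hf]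
    omega
  exact pointedRow_of_parallel_pair_of_fact hfact M hf hg hfg' hf1 hg1 hfg hpf hpg k hk
    (fun hk1 => h₁ (k - 1) (by rw [hN1]; omega)) (fun hk1 => h₂ (k - 1) (by rw [hN2]; omega))

/-- **MINIMAL (Ĉ)-WITNESSES HAVE NO PARALLEL PAIR AVOIDING `p`** (CONDITIONAL on the named fact): a failure of (Ĉ)
at `(M, p)` with a parallel pair `{f, g} ∌ p` is already a failure at `((M ∖ g) / f, p)` or at `((M ∖ f) / g, p)`,
on `#E − 2` elements. -/
theorem not_pointedRowAt_parallel_pair_of_fact (hfact : BiIndepDensityLogConcave α) (M : Matroid α) [M.Finite]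
    {p f g : α} (hf : f ∈ gr M) (hg : g ∈ gr M) (hfg' : f ≠ g) (hf1 : rk M {f} = 1) (hg1 : rk M {g} = 1)
    (hfg : rk M {f, g} = 1) (hpf : p ≠ f) (hpg : p ≠ g) (h : ¬ PointedRowAt M p) :
    ¬ PointedRowAt ((M ＼ ({g} : Set α)) ／ ({f} : Set α)) p ∨
      ¬ PointedRowAt ((M ＼ ({f} : Set α)) ／ ({g} : Set α)) p := by
  by_cases h₁ : PointedRowAt ((M ＼ ({g} : Set α)) ／ ({f} : Set α)) p
  · right
    exact fun h₂ => h (pointedRowAt_of_parallel_pair_of_fact hfact M hf hg hfg' hf1 hg1 hfg hpf hpg h₁ h₂)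
  · left
    exact h₁

end parallel

end PercRepro.Cogirth
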